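import Mathlib
import HarnessLib

/-!
# Shelf crux `EnstrophyQuarterLaw` (stmt-NavierStokesRegularity-1574): the multi-scale (dyadic) assembly of a
# DENSITY sieve — from "good at scale `r` ⟹ pointwise bound `c(r)`" and "the bad set at scale `r` is small"
# to a bound on `∫_A g`

Helper file (`--supports stmt-NavierStokesRegularity-1574 --as helper`; def-free; seat
leafhand-ns-efficiencyfloor-4 g10; companion of `…EnstrophyQuarterLawDensitySieveCount`). Context. In a
density sieve for the slice enstrophy of a hypothetical first blow-up (`g = |∇u(t₀,·)|²` on a ball `A = B_R`), an
ε-regularity criterion of Choe–Wolf–Yang type [cite: ChoeWolfYang2019, Thm 1] makes every point OUTSIDE the bad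
set `D_k` of scale `r_k = r₀ 2^{-k}` satisfy `g ≤ c_k` (`c_k ≍ r_k⁻⁴`), the Chebyshev/Vitali count
(`DensitySieve.exists_finite_cover_densityBad`) makes `μ D_k ≲ N r_k³` UNIFORMLY in the scale, and a sup-norm
bound on the slice makes every point good at some finest scale `r_K` (`D_K ∩ A = ∅`). This file proves the
bookkeeping that turns these three inputs into `∫_A g ≤ c_0 μ A + Σ_{k<K} c_{k+1} μ D_k`
(`setLIntegral_le_of_sieve`, from the pointwise stopping-scale bound `le_head_add_sum_indicator`), and its
evaluation for geometric data `c_k = c (2^k)⁴ / r₀⁴`, `μ D_k ≤ m r₀³ / (2^k)³`: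
`∫_A g ≤ (c/r₀⁴) μ A + 16 c m 2^K / r₀` (`setLIntegral_le_of_dyadic_sieve`) — linear in the inverse finest
scale `2^K/r₀ = 1/r_K`, which is what produces a `(T − t)^{-1/2}` slice law when `r_K ≍ √(T − t)`.

HONEST FRAMING: elementary measure theory / arithmetic; no statement about Navier–Stokes, no registered stub of
line «sparse_sieve» is closed, the crux `EnstrophyQuarterLaw` stays OPEN and no summit statement is proved.
[folklore]
-/

noncomputable section

-- the summit and its single sub-problem share the name (CONVENTIONS §1), as in every Theorems file
set_option linter.dupNamespace false

namespace Summit.NavierStokesRegularity.NavierStokesRegularity.Theorems.EnstrophyQuarterLaw.DensitySieve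

open MeasureTheory Set
open scoped ENNReal

/-- **Stopping-scale bound (pointwise).** If outside `D k` (the bad set of the `k`-th scale) `g ≤ c k` on `A`
for every `k ≤ K`, and no point of `A` is bad at the last scale `K`, then at each `x ∈ A`
`g x ≤ c 0 + Σ_{k<K} c (k+1) · 𝟙_{D k}(x)`: either `x` is good at scale `0`, or its first good scale `k₀ ≥ 1`
has `x ∈ D (k₀-1)` and `g x ≤ c k₀`, one summand. [folklore] -/
theorem le_head_add_sum_indicator {α : Type*} (A : Set α) (g : α → ℝ≥0∞) (K : ℕ) (D : ℕ → Set α)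
    (c : ℕ → ℝ≥0∞) (hgood : ∀ k ≤ K, ∀ x ∈ A, x ∉ D k → g x ≤ c k) (hlast : ∀ x ∈ A, x ∉ D K)
    {x : α} (hx : x ∈ A) :
    g x ≤ c 0 + ∑ k ∈ Finset.range K, c (k + 1) * (D k).indicator 1 x := by
  classical
  by_cases h0 : x ∈ D 0
  · have hex : ∃ k, x ∉ D k := ⟨K, hlast x hx⟩
    obtain ⟨k₀, hk₀spec, hk₀min⟩ : ∃ k₀, x ∉ D k₀ ∧ ∀ m < k₀, x ∈ D m :=
      ⟨Nat.find hex, Nat.find_spec hex, fun m hm => by simpa using Nat.find_min hex hm⟩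
    have hk₀K : k₀ ≤ K := by
      by_contra hlt
      exact hlast x hx (hk₀min K (by omega))
    have hk₀pos : k₀ ≠ 0 := by
      rintro rfl
      exact hk₀spec h0
    obtain ⟨j, rfl⟩ : ∃ j, k₀ = j + 1 := Nat.exists_eq_succ_of_ne_zero hk₀pos
    have hjD : x ∈ D j := hk₀min j (by omega)
    have hjK : j ∈ Finset.range K := Finset.mem_range.2 (by omega)
    calc g x ≤ c (j + 1) := hgood (j + 1) hk₀K x hx hk₀spec
      _ = c (j + 1) * (D j).indicator 1 x := by simp [Set.indicator_of_mem hjD]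
      _ ≤ ∑ k ∈ Finset.range K, c (k + 1) * (D k).indicator 1 x :=
          Finset.single_le_sum (f := fun k => c (k + 1) * (D k).indicator 1 x)
            (fun _ _ => zero_le) hjK
      _ ≤ _ := le_add_self
  · calc g x ≤ c 0 := hgood 0 (Nat.zero_le _) x hx h0
      _ ≤ _ := le_self_add

/-- **Sieve assembly (abstract).** With measurable `A` and bad sets `D k`: if `g ≤ c k` on `A \ D k` for all
`k ≤ K` and `A ∩ D K = ∅`, then `∫_A g dμ ≤ c 0 · μ A + Σ_{k<K} c (k+1) · μ (D k)`. [folklore] -/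
theorem setLIntegral_le_of_sieve {α : Type*} [MeasurableSpace α] (μ : Measure α) (A : Set α)
    (hA : MeasurableSet A) (g : α → ℝ≥0∞) (K : ℕ) (D : ℕ → Set α) (hD : ∀ k, MeasurableSet (D k))
    (c : ℕ → ℝ≥0∞) (hgood : ∀ k ≤ K, ∀ x ∈ A, x ∉ D k → g x ≤ c k) (hlast : ∀ x ∈ A, x ∉ D K) :
    ∫⁻ x in A, g x ∂μ ≤ c 0 * μ A + ∑ k ∈ Finset.range K, c (k + 1) * μ (D k) := by
  have hmeas : ∀ k ∈ Finset.range K, Measurable fun x => c (k + 1) * (D k).indicator 1 x :=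
    fun k _ => (measurable_one.indicator (hD k)).const_mul _
  calc ∫⁻ x in A, g x ∂μ
      ≤ ∫⁻ x in A, (c 0 + ∑ k ∈ Finset.range K, c (k + 1) * (D k).indicator 1 x) ∂μ :=
        setLIntegral_mono' hA fun x hx => le_head_add_sum_indicator A g K D c hgood hlast hx
    _ = ∫⁻ _ in A, c 0 ∂μ + ∫⁻ x in A, (∑ k ∈ Finset.range K, c (k + 1) * (D k).indicator 1 x) ∂μ :=
        lintegral_add_left measurable_const _
    _ = c 0 * μ A + ∑ k ∈ Finset.range K, ∫⁻ x in A, c (k + 1) * (D k).indicator 1 x ∂μ := by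
        rw [setLIntegral_const, lintegral_finsetSum _ hmeas]
    _ ≤ c 0 * μ A + ∑ k ∈ Finset.range K, c (k + 1) * μ (D k) := by
        gcongr with k hk
        calc ∫⁻ x in A, c (k + 1) * (D k).indicator 1 x ∂μ
            = c (k + 1) * ∫⁻ x in A, (D k).indicator 1 x ∂μ :=
              lintegral_const_mul _ (measurable_one.indicator (hD k))
          _ ≤ c (k + 1) * ∫⁻ x, (D k).indicator 1 x ∂μ := by
              gcongr
              exact Measure.restrict_le_self
          _ = c (k + 1) * μ (D k) := by rw [lintegral_indicator_one (hD k)]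

/-- The dyadic sum behind the quarter-rate: `Σ_{k<K} (2^(k+1))⁴ / (2^k)³ = 16 (2^K − 1) ≤ 16 · 2^K`.
[folklore] -/
theorem sum_dyadic_ratio_le (K : ℕ) :
    ∑ k ∈ Finset.range K, ((2 : ℝ) ^ (k + 1)) ^ 4 / ((2 : ℝ) ^ k) ^ 3 ≤ 16 * 2 ^ K := by
  have hterm : ∀ k ∈ Finset.range K, ((2 : ℝ) ^ (k + 1)) ^ 4 / ((2 : ℝ) ^ k) ^ 3 = 16 * 2 ^ k := by
    intro k _
    have h2k : (0 : ℝ) < 2 ^ k := by positivity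
    field_simp
    ring
  rw [Finset.sum_congr rfl hterm, ← Finset.mul_sum, geom_sum_eq (by norm_num) K]
  have h2K : (1 : ℝ) ≤ 2 ^ K := one_le_pow₀ (by norm_num)
  nlinarith

/-- **Sieve assembly, dyadic scales with the quarter-rate constants.** Scales `r_k = r₀/2^k`, `k = 0,…,K`;
goodness outside `D k` gives `g ≤ c (2^k)⁴/r₀⁴ = c/r_k⁴`; the bad sets obey `μ (D k) ≤ m r₀³/(2^k)³ = m r_k³`
(uniform count `×` ball volume); nothing in `A` is bad at the finest scale `K`. Then
`∫_A g dμ ≤ (c/r₀⁴) μ A + 16 c m · 2^K / r₀`, i.e. `… + 16 c m / r_K`: LINEAR in the inverse finest scale.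
[folklore] -/
theorem setLIntegral_le_of_dyadic_sieve {α : Type*} [MeasurableSpace α] (μ : Measure α) (A : Set α)
    (hA : MeasurableSet A) (g : α → ℝ≥0∞) (K : ℕ) (D : ℕ → Set α) (hD : ∀ k, MeasurableSet (D k))
    {c m r₀ : ℝ} (hc : 0 ≤ c) (hm : 0 ≤ m) (hr₀ : 0 < r₀)
    (hgood : ∀ k ≤ K, ∀ x ∈ A, x ∉ D k → g x ≤ ENNReal.ofReal (c * (2 ^ k) ^ 4 / r₀ ^ 4))
    (hbad : ∀ k < K, μ (D k) ≤ ENNReal.ofReal (m * r₀ ^ 3 / (2 ^ k) ^ 3))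
    (hlast : ∀ x ∈ A, x ∉ D K) :
    ∫⁻ x in A, g x ∂μ ≤
      ENNReal.ofReal (c / r₀ ^ 4) * μ A + ENNReal.ofReal (16 * c * m * 2 ^ K / r₀) := by
  have h1 := setLIntegral_le_of_sieve μ A hA g K D hD
    (fun k => ENNReal.ofReal (c * (2 ^ k) ^ 4 / r₀ ^ 4)) hgood hlast
  have h0 : ENNReal.ofReal (c * (2 ^ 0) ^ 4 / r₀ ^ 4) = ENNReal.ofReal (c / r₀ ^ 4) := by norm_num
  rw [h0] at h1
  refine h1.trans (add_le_add le_rfl ?_)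
  -- bound each summand by a real number and sum the dyadic series
  have hsum : ∀ k ∈ Finset.range K,
      ENNReal.ofReal (c * (2 ^ (k + 1)) ^ 4 / r₀ ^ 4) * μ (D k) ≤
        ENNReal.ofReal (c * m / r₀ * (((2 : ℝ) ^ (k + 1)) ^ 4 / ((2 : ℝ) ^ k) ^ 3)) := by
    intro k hk
    have hk' : k < K := Finset.mem_range.1 hk
    calc ENNReal.ofReal (c * (2 ^ (k + 1)) ^ 4 / r₀ ^ 4) * μ (D k)
        ≤ ENNReal.ofReal (c * (2 ^ (k + 1)) ^ 4 / r₀ ^ 4) * ENNReal.ofReal (m * r₀ ^ 3 / (2 ^ k) ^ 3) :=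
          by gcongr; exact hbad k hk'
      _ = ENNReal.ofReal (c * m / r₀ * (((2 : ℝ) ^ (k + 1)) ^ 4 / ((2 : ℝ) ^ k) ^ 3)) := by
          rw [← ENNReal.ofReal_mul (by positivity)]
          congr 1
          have h2k : (0 : ℝ) < 2 ^ k := by positivity
          field_simp
  calc ∑ k ∈ Finset.range K, ENNReal.ofReal (c * (2 ^ (k + 1)) ^ 4 / r₀ ^ 4) * μ (D k)
      ≤ ∑ k ∈ Finset.range K, ENNReal.ofReal (c * m / r₀ * (((2 : ℝ) ^ (k + 1)) ^ 4 / ((2 : ℝ) ^ k) ^ 3)) :=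
        Finset.sum_le_sum hsum
    _ = ENNReal.ofReal (∑ k ∈ Finset.range K, c * m / r₀ * (((2 : ℝ) ^ (k + 1)) ^ 4 / ((2 : ℝ) ^ k) ^ 3)) :=
        (ENNReal.ofReal_sum_of_nonneg fun k _ => by positivity).symm
    _ ≤ ENNReal.ofReal (16 * c * m * 2 ^ K / r₀) := by
        apply ENNReal.ofReal_le_ofReal
        rw [← Finset.mul_sum]
        have hcm : 0 ≤ c * m / r₀ := by positivity
        calc c * m / r₀ * ∑ k ∈ Finset.range K, ((2 : ℝ) ^ (k + 1)) ^ 4 / ((2 : ℝ) ^ k) ^ 3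
            ≤ c * m / r₀ * (16 * 2 ^ K) := mul_le_mul_of_nonneg_left (sum_dyadic_ratio_le K) hcm
          _ = 16 * c * m * 2 ^ K / r₀ := by ring

end Summit.NavierStokesRegularity.NavierStokesRegularity.Theorems.EnstrophyQuarterLaw.DensitySieve

end
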